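import Mathlib
import Summits.QuantumFields.BalabanUV.Beta.FP.RepAssembly
import Summits.QuantumFields.BalabanUV.Beta.FP.TailShellBound

/-!
# `BalabanUV.Beta.FP.LegsShellBound` — road «FP» for binder row D1, N7 ∕ `hrep` row «LEGS» (window half): THE WINDOW BOUND `hlegs` OF
# `FP/RepAssembly.hrep_of_basePoint` FROM A POINTWISE SEPTIC GERM ON THE WINDOW SHELLS — contact constant `U₁ = 160·D`; TABLE PERTURBATIONS ONE
# POWER BETTER THAN MARGINAL MOVE `U₁` BY `160·D′`; the assembled `hrep` from {base-point currency, GERM, TAILS}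
# (β sub-cell, lane beta-asym1 = unit `b2b-balaban-beta-asym1`, gen 47; sub-row «LEGS-SHELL» — the sibling of leaf-06's `FP/TailShellBound` «TAILS-SHELL»)

NOT IN PRINT; OUR BOOKKEEPING.  HONEST FRAMING (cell charter, verbatim): «discharging `BetaPertH` makes Bałaban's UV stability UNCONDITIONAL — a real
constructive-QFT result; it is NOT the continuum limit and NOT the Clay problem.»  HONEST DEPENDENCY (verbatim): «continuum YM on T⁴ ⇐ BetaPertH ∧ nine spine
estimates (0/9 proved); BetaPertH ⇐ (D1) ∧ (D4) ∧ CAP+tail; G-an2-4 gates asym, D1 and NE2/3/4.»  [folklore] lattice power counting in `ℤ⁴` composed BY NAME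
from the tree (`TransferUV.abs_sum_le_of_quintic`: a kernel `≤ D/(r+1)⁵` shellwise has window sums `≤ 160·D` for EVERY radius — `#shell ≤ 80(r+1)³`,
`Σ(r+1)⁻² ≤ 2`; `TailShellBound.abs_toReal_le_succ_of_mem_annulus`: `|w_μ| ≤ r+1` on the shell; `RepAssembly.hrep_of_basePoint*`).  No statement of
Bałaban's papers, no `[cite:]`, no `def`, no `def … : Prop`; instantiates NO binder of the β-function wall.  It is NOT the LEGS row itself: the GERM INPUT —
the pointwise bound `|n⁻⁸·𝔅_b(w) − Σ_i cc₀ i·F′ b i w·G′ b i w| ≤ D/(r+1)⁷` on the window shells for the base-point kernels of the fine Hessian of the perfect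
objects (`REP-DESIGN.md` (L1)–(L2): exact vertex algebra + Taylor pairing of the exponentially localised stencil profiles against the legs, one power better
than the marginal `‖w‖⁻⁶`), with an `n`-FREE `D` — is the instantiator's (road FP owner `b2b-balaban-beta-d1-p3` ∕ `beta-d1-formalise-leaf-02` «LEGS generic
pairing»).  NOT `hrep`, NOT N7, NOT D1, NOT `BetaPertH`, NOT continuum, NOT Clay.

WHY THE GERM IS A WINDOW STATEMENT (design note).  `RepAssembly.hrep_of_basePoint` splits `fullSum (Φ b)` at the window radius `R₀`: inside, the window
sum `psum (Φ b) R₀` is compared with the leg table (binder `hlegs`, budget `U₁`); outside, the massive shell tails `E/(r+1)⁴·e^{−(δ/Lr)(r+1)}` (binder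
`htail`) replace the table.  Beyond the window the table `w_μw_ν·Σ_i cc₀ i F′G′ ∼ ‖w‖⁻⁴` is NOT matched by the exponentially small kernel, so the septic
germ `|n⁻⁸𝔅 − table| ≤ D‖w‖⁻⁷` can hold with an `n`-free `D` only on the shells `r + 1 ≤ R₀` INSIDE the window — which is all `hlegs` needs: the germ
hypotheses below are asked only there (a kernel truncated to the window is still quintic shellwise with the same constant, so `abs_sum_le_of_quintic`
applies verbatim).

CONTENT (all [folklore]; `Pt = Fin 4 → ℤ`, `toReal`, `supNorm`, `annulus`, `psum`, `fullSum` are the tree's).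
* §1 shell facts: `abs_weight_le_sq` (`|w_μ·w_ν| ≤ (r+1)²` on `annulus 4 r (r+1)`), `succ_le_of_mem_shell_of_mem_window` (a shell meeting the window
  `annulus 4 0 R₀` has `r + 1 ≤ R₀`).
* §2 **`abs_windowSum_le_of_quinticWindow`**: `|g| ≤ D/(r+1)⁵` on the shells inside the window ⇒ `|Σ_{w ∈ annulus 4 0 R₀} g w| ≤ 160·D`;
  **`hlegs_of_quinticWindow`**: `|Φ w − w_μw_ν·T w| ≤ D/(r+1)⁵` on the window shells ⇒ `|psum Φ R₀ − Σ_{window} w_μw_ν·T w| ≤ 160·D` — the `hlegs` SHAPE.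
* §3 **`hlegs_of_germWindow`**: in the base-point currency `Φ w = a·(w_μ·w_ν·K w)` (`FP/PerfectRepBasePoint`: `a = n⁻⁸`, `K` = the base-point kernel),
  the SEPTIC GERM `|a·K w − T w| ≤ D/(r+1)⁷` on the window shells ⇒ `hlegs` with `U₁ := 160·D`; **`hlegs_family_of_germWindow`**: the `∀ b ∈ Bset` form with
  the table `T b w := Σ_{i∈s} cc₀ i·(F′ b i w·G′ b i w)` — LITERALLY the `hlegs` binder of `RepAssembly.hrep_of_basePoint` ∕ `_uniform` ∕ `_nUniform`.
* §4 table perturbations one power better (the window half of GERM-K (G1) «perfect table = free table + O(1) uniformly in n»):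
  `sum_mul_sub_sum_mul_le_septic` (product rule: envelopes `|F i| ≤ f i/x^{p i}`, `|G₁ i| ≤ g i/x^{q i}`, `p i + q i = 6`, perturbations
  `|F₁ i − F i| ≤ eF i/x^{p i+1}`, `|G₁ i − G i| ≤ eG i/x^{q i+1}` ⇒ `|Σ cc₀(FG) − Σ cc₀(F₁G₁)| ≤ (Σ|cc₀ i|(eF i·g i + f i·eG i))/x⁷`);
  **`hlegs_of_hlegs_of_septicWindow`** (`hlegs` for `T` with `U₁` and `|T − T₁| ≤ D′/(r+1)⁷` on the window shells ⇒ `hlegs` for `T₁` with `U₁ + 160·D′`);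
  **`hlegs_of_hlegs_of_legEnvelopes`** (the same with `D′ := Σ_i |cc₀ i|(eF i·g i + f i·eG i)` from shellwise leg envelopes).
* §5 **`hrep_of_germWindow`** ∕ **`_uniform`** ∕ **`_nUniform`**: `RepAssembly.hrep_of_basePoint*` with `hlegs` DISCHARGED by §3 — base-point currency + window
  GERM (`D`) + shell TAILS (`E`, `δ`) ⇒ `|g − Σ_b wt b·(window leg bilinear)| ≤ 160·D + 80·E·(1+Lr/δ)/(R₀+1)`, resp. the `R₀`-free `160·D + 80·E·(1+Lr/δ)`,
  resp. the `n`-FREE `160·D + 80·E·(1+1/δ)` (tail scale `Lr := n`, window `n ≤ R₀+1`): road FP's `hrep` binder from TWO POINTWISE statements per base point.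
Provenance: lane beta-asym1 (planner seat, gen 47), 2026-08-20; STAGED for a prover-role courier (a planner seat cannot file under `Summits/`); no existing
file touched.  ABSOLUTE RULE (cell charter): nothing internally minted is cited; every hypothesis is displayed.
-/

noncomputable section

open Finset Real
open scoped BigOperators

namespace Summit.QuantumFields.BalabanUV.Beta.FP.LegsShellBound

open Literature.Probability.LatticeModels (annulus)
open Literature.MathematicalPhysics.QuantumFieldTheory.Balaban1983to89.Beta
open Literature.MathematicalPhysics.QuantumFieldTheory.Balaban1983to89.Beta.DyadicShell (Pt toReal toReal_apply supNorm mem_annulus_iff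
  supNorm_eq_of_mem_sphere)
open Literature.MathematicalPhysics.QuantumFieldTheory.Balaban1983to89.Beta.WindowIdentification (psum psum_def fullSum)
open Literature.MathematicalPhysics.QuantumFieldTheory.Balaban1983to89.Beta.TransferUV (abs_sum_le_of_quintic)
open TailShellBound (abs_toReal_le_succ_of_mem_annulus)

/-! ## §1 Shell facts -/

/-- [folklore] On the shell `annulus 4 r (r+1)` the (1.22)-moment weight is at most `(r+1)²`: `|w_μ·w_ν| ≤ (r+1)²`. -/
theorem abs_weight_le_sq {r : ℕ} {w : Pt} (hw : w ∈ annulus 4 r (r + 1)) (μ ν : Fin 4) :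
    |toReal w μ * toReal w ν| ≤ ((r : ℝ) + 1) ^ 2 := by
  rw [abs_mul, sq]
  exact mul_le_mul (abs_toReal_le_succ_of_mem_annulus hw μ) (abs_toReal_le_succ_of_mem_annulus hw ν) (abs_nonneg _)
    (by positivity)

/-- [folklore] A shell that meets the window lies inside it: `w ∈ annulus 4 r (r+1)` and `w ∈ annulus 4 0 R₀` give `r + 1 ≤ R₀`. -/
theorem succ_le_of_mem_shell_of_mem_window {r R₀ : ℕ} {w : Pt} (hw : w ∈ annulus 4 r (r + 1)) (hw' : w ∈ annulus 4 0 R₀) :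
    r + 1 ≤ R₀ := by
  have h1 := supNorm_eq_of_mem_sphere hw
  have h2 := (mem_annulus_iff.mp hw').2
  omega

/-! ## §2 Window sums of kernels that are quintic on the window shells -/

/-- [folklore] **QUINTIC ON THE WINDOW SHELLS ⇒ WINDOW SUM `≤ 160·D`.**  If `|g w| ≤ D/(r+1)⁵` on every shell `annulus 4 r (r+1)` with `r + 1 ≤ R₀`
(`0 ≤ D`), then `|Σ_{w ∈ annulus 4 0 R₀} g w| ≤ 160·D` (`TransferUV.abs_sum_le_of_quintic` applied to `g` truncated to the window). -/
theorem abs_windowSum_le_of_quinticWindow {g : Pt → ℝ} {D : ℝ} (hD : 0 ≤ D) {R₀ : ℕ}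
    (hg : ∀ r : ℕ, r + 1 ≤ R₀ → ∀ w ∈ annulus 4 r (r + 1), |g w| ≤ D / ((r : ℝ) + 1) ^ 5) :
    |∑ w ∈ annulus 4 0 R₀, g w| ≤ 160 * D := by
  classical
  have key : |∑ w ∈ annulus 4 0 R₀, (if w ∈ annulus 4 0 R₀ then g w else 0)| ≤ 160 * D :=
    abs_sum_le_of_quintic (f := fun w => if w ∈ annulus 4 0 R₀ then g w else 0) hD fun r w hw => by
      by_cases hw' : w ∈ annulus 4 0 R₀
      · rw [if_pos hw']
        exact hg r (succ_le_of_mem_shell_of_mem_window hw hw') w hw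
      · rw [if_neg hw', abs_zero]
        positivity
  have e : ∑ w ∈ annulus 4 0 R₀, g w = ∑ w ∈ annulus 4 0 R₀, (if w ∈ annulus 4 0 R₀ then g w else 0) :=
    sum_congr rfl fun w hw => by rw [if_pos hw]
  rw [e]
  exact key

/-- [folklore] **THE `hlegs` SHAPE FROM A QUINTIC WINDOW DIFFERENCE.**  If `|Φ w − w_μ·w_ν·T w| ≤ D/(r+1)⁵` on every window shell (`r + 1 ≤ R₀`), then
`|psum Φ R₀ − Σ_{w ∈ annulus 4 0 R₀} w_μ·w_ν·T w| ≤ 160·D`. -/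
theorem hlegs_of_quinticWindow {Φ T : Pt → ℝ} {μ ν : Fin 4} {D : ℝ} (hD : 0 ≤ D) {R₀ : ℕ}
    (h : ∀ r : ℕ, r + 1 ≤ R₀ → ∀ w ∈ annulus 4 r (r + 1), |Φ w - toReal w μ * toReal w ν * T w| ≤ D / ((r : ℝ) + 1) ^ 5) :
    |psum Φ R₀ - ∑ w ∈ annulus 4 0 R₀, toReal w μ * toReal w ν * T w| ≤ 160 * D := by
  rw [psum_def, ← sum_sub_distrib]
  exact abs_windowSum_le_of_quinticWindow hD h

/-! ## §3 The base-point currency: a SEPTIC germ for the kernel gives `hlegs` with `U₁ = 160·D` -/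

/-- [folklore] **`hlegs` FROM THE SEPTIC GERM.**  In the currency `Φ w = a·(w_μ·w_ν·K w)`, if `|a·K w − T w| ≤ D/(r+1)⁷` on every window shell
(`r + 1 ≤ R₀`; `0 ≤ D`), then — since `|w_μ·w_ν| ≤ (r+1)²` there — `|psum Φ R₀ − Σ_{window} w_μ·w_ν·T w| ≤ 160·D`. -/
theorem hlegs_of_germWindow {Φ K T : Pt → ℝ} {a : ℝ} {μ ν : Fin 4} (hΦ : ∀ w, Φ w = a * (toReal w μ * toReal w ν * K w))
    {D : ℝ} (hD : 0 ≤ D) {R₀ : ℕ}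
    (hgerm : ∀ r : ℕ, r + 1 ≤ R₀ → ∀ w ∈ annulus 4 r (r + 1), |a * K w - T w| ≤ D / ((r : ℝ) + 1) ^ 7) :
    |psum Φ R₀ - ∑ w ∈ annulus 4 0 R₀, toReal w μ * toReal w ν * T w| ≤ 160 * D := by
  refine hlegs_of_quinticWindow hD fun r hr w hw => ?_
  have hr0 : (0 : ℝ) < (r : ℝ) + 1 := by positivity
  have e : a * (toReal w μ * toReal w ν * K w) - toReal w μ * toReal w ν * T w
      = (toReal w μ * toReal w ν) * (a * K w - T w) := by ring
  rw [hΦ w, e, abs_mul]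
  calc |toReal w μ * toReal w ν| * |a * K w - T w| ≤ ((r : ℝ) + 1) ^ 2 * (D / ((r : ℝ) + 1) ^ 7) :=
        mul_le_mul (abs_weight_le_sq hw μ ν) (hgerm r hr w hw) (abs_nonneg _) (by positivity)
    _ = D / ((r : ℝ) + 1) ^ 5 := by field_simp

section Family

variable {κB ι : Type*} {Bset : Finset κB} {Φ K : κB → Pt → ℝ} {s : Finset ι} {cc₀ : ι → ℝ} {F' G' : κB → ι → Pt → ℝ}
  {μ ν : Fin 4} {a : ℝ}

/-- [folklore] **THE `hlegs` BINDER OF `RepAssembly.hrep_of_basePoint`, LITERALLY, FROM THE SEPTIC GERM PER BASE POINT**: currency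
`Φ b w = a·(w_μ·w_ν·K b w)`, germ `|a·K b w − Σ_{i∈s} cc₀ i·(F′ b i w·G′ b i w)| ≤ D/(r+1)⁷` on the window shells, for every `b ∈ Bset` ⇒
`∀ b ∈ Bset, |psum (Φ b) R₀ − Σ_{w ∈ annulus 4 0 R₀} w_μ·w_ν·Σ_i cc₀ i·(F′ b i w·G′ b i w)| ≤ 160·D`. -/
theorem hlegs_family_of_germWindow (hΦ : ∀ b ∈ Bset, ∀ w, Φ b w = a * (toReal w μ * toReal w ν * K b w)) {D : ℝ} (hD : 0 ≤ D)
    {R₀ : ℕ}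
    (hgerm : ∀ b ∈ Bset, ∀ r : ℕ, r + 1 ≤ R₀ → ∀ w ∈ annulus 4 r (r + 1),
      |a * K b w - ∑ i ∈ s, cc₀ i * (F' b i w * G' b i w)| ≤ D / ((r : ℝ) + 1) ^ 7) :
    ∀ b ∈ Bset, |psum (Φ b) R₀
        - ∑ w ∈ annulus 4 0 R₀, toReal w μ * toReal w ν * ∑ i ∈ s, cc₀ i * (F' b i w * G' b i w)| ≤ 160 * D :=
  fun b hb => hlegs_of_germWindow (T := fun w => ∑ i ∈ s, cc₀ i * (F' b i w * G' b i w)) (hΦ b hb) hD (hgerm b hb)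

end Family

/-! ## §4 Table perturbations one power better than marginal move `U₁` by `160·D′` -/

/-- [folklore] **PRODUCT RULE, ONE POWER BETTER.**  Numbers `F i, G i` (the table legs) and `F₁ i, G₁ i` (perturbed legs) with envelopes
`|F i| ≤ f i/x^{p i}`, `|G₁ i| ≤ g i/x^{q i}`, total degree `p i + q i = 6`, and perturbations `|F₁ i − F i| ≤ eF i/x^{p i + 1}`,
`|G₁ i − G i| ≤ eG i/x^{q i + 1}` (any real `x`; the bounds carry their own signs): `|Σ_i cc₀ i·(F i·G i) − Σ_i cc₀ i·(F₁ i·G₁ i)| ≤ (Σ_i |cc₀ i|·(eF i·g i + f i·eG i))/x⁷`. -/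
theorem sum_mul_sub_sum_mul_le_septic {ι : Type*} (s : Finset ι) (cc₀ : ι → ℝ) {F G F₁ G₁ : ι → ℝ} {p q : ι → ℕ}
    {f g eF eG : ι → ℝ} {x : ℝ} (hdeg : ∀ i ∈ s, p i + q i = 6)
    (hF : ∀ i ∈ s, |F i| ≤ f i / x ^ p i) (hG₁ : ∀ i ∈ s, |G₁ i| ≤ g i / x ^ q i)
    (hEF : ∀ i ∈ s, |F₁ i - F i| ≤ eF i / x ^ (p i + 1)) (hEG : ∀ i ∈ s, |G₁ i - G i| ≤ eG i / x ^ (q i + 1)) :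
    |∑ i ∈ s, cc₀ i * (F i * G i) - ∑ i ∈ s, cc₀ i * (F₁ i * G₁ i)|
      ≤ (∑ i ∈ s, |cc₀ i| * (eF i * g i + f i * eG i)) / x ^ 7 := by
  rw [← sum_sub_distrib, sum_div]
  refine (abs_sum_le_sum_abs _ _).trans (sum_le_sum fun i hi => ?_)
  have h7a : x ^ (p i + 1) * x ^ q i = x ^ 7 := by
    rw [← pow_add]; congr 1; have := hdeg i hi; omega
  have h7b : x ^ p i * x ^ (q i + 1) = x ^ 7 := by
    rw [← pow_add]; congr 1; have := hdeg i hi; omega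
  have e : cc₀ i * (F i * G i) - cc₀ i * (F₁ i * G₁ i) = -(cc₀ i * ((F₁ i - F i) * G₁ i + F i * (G₁ i - G i))) := by ring
  rw [e, abs_neg, abs_mul]
  calc |cc₀ i| * |(F₁ i - F i) * G₁ i + F i * (G₁ i - G i)|
      ≤ |cc₀ i| * (eF i / x ^ (p i + 1) * (g i / x ^ q i) + f i / x ^ p i * (eG i / x ^ (q i + 1))) := by
        refine mul_le_mul_of_nonneg_left ?_ (abs_nonneg _)
        refine (abs_add_le _ _).trans (add_le_add ?_ ?_)
        · rw [abs_mul]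
          exact mul_le_mul (hEF i hi) (hG₁ i hi) (abs_nonneg _) ((abs_nonneg _).trans (hEF i hi))
        · rw [abs_mul]
          exact mul_le_mul (hF i hi) (hEG i hi) (abs_nonneg _) ((abs_nonneg _).trans (hF i hi))
    _ = |cc₀ i| * (eF i * g i + f i * eG i) / x ^ 7 := by
        rw [div_mul_div_comm, div_mul_div_comm, h7a, h7b]; ring

/-- [folklore] **`hlegs` IS STABLE UNDER SEPTIC TABLE PERTURBATIONS.**  If `hlegs` holds for the table `T` with budget `U₁` and `|T w − T₁ w| ≤ D′/(r+1)⁷`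
on the window shells (`0 ≤ D′`), then `hlegs` holds for `T₁` with budget `U₁ + 160·D′`. -/
theorem hlegs_of_hlegs_of_septicWindow {Φ T T₁ : Pt → ℝ} {μ ν : Fin 4} {U₁ D' : ℝ} (hD' : 0 ≤ D') {R₀ : ℕ}
    (hlegs : |psum Φ R₀ - ∑ w ∈ annulus 4 0 R₀, toReal w μ * toReal w ν * T w| ≤ U₁)
    (hTT : ∀ r : ℕ, r + 1 ≤ R₀ → ∀ w ∈ annulus 4 r (r + 1), |T w - T₁ w| ≤ D' / ((r : ℝ) + 1) ^ 7) :
    |psum Φ R₀ - ∑ w ∈ annulus 4 0 R₀, toReal w μ * toReal w ν * T₁ w| ≤ U₁ + 160 * D' := by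
  have h2 : |∑ w ∈ annulus 4 0 R₀, toReal w μ * toReal w ν * T w - ∑ w ∈ annulus 4 0 R₀, toReal w μ * toReal w ν * T₁ w|
      ≤ 160 * D' := by
    rw [← sum_sub_distrib]
    refine abs_windowSum_le_of_quinticWindow hD' fun r hr w hw => ?_
    have hr0 : (0 : ℝ) < (r : ℝ) + 1 := by positivity
    rw [← mul_sub, abs_mul]
    calc |toReal w μ * toReal w ν| * |T w - T₁ w| ≤ ((r : ℝ) + 1) ^ 2 * (D' / ((r : ℝ) + 1) ^ 7) :=
          mul_le_mul (abs_weight_le_sq hw μ ν) (hTT r hr w hw) (abs_nonneg _) (by positivity)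
      _ = D' / ((r : ℝ) + 1) ^ 5 := by field_simp
  have e : psum Φ R₀ - ∑ w ∈ annulus 4 0 R₀, toReal w μ * toReal w ν * T₁ w
      = (psum Φ R₀ - ∑ w ∈ annulus 4 0 R₀, toReal w μ * toReal w ν * T w)
        + (∑ w ∈ annulus 4 0 R₀, toReal w μ * toReal w ν * T w - ∑ w ∈ annulus 4 0 R₀, toReal w μ * toReal w ν * T₁ w) := by
    ring
  rw [e]
  exact (abs_add_le _ _).trans (add_le_add hlegs h2)

section Envelopes

variable {ι : Type*} {s : Finset ι} {cc₀ : ι → ℝ} {F G F₁ G₁ : ι → Pt → ℝ} {p q : ι → ℕ} {f g eF eG : ι → ℝ}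
  {Φ : Pt → ℝ} {μ ν : Fin 4} {U₁ : ℝ} {R₀ : ℕ}

/-- [folklore] **`hlegs` TRANSFERS BETWEEN TWO LEG TABLES WHOSE LEGS DIFFER ONE POWER BETTER** (the window half of GERM-K (G1): e.g. perfect legs vs
free legs).  Shellwise on the window: envelopes `|F i w| ≤ f i/(r+1)^{p i}`, `|G₁ i w| ≤ g i/(r+1)^{q i}` with `p i + q i = 6`, perturbations
`|F₁ i w − F i w| ≤ eF i/(r+1)^{p i+1}`, `|G₁ i w − G i w| ≤ eG i/(r+1)^{q i+1}` (all constants `≥ 0`) ⇒ `hlegs` for `(F, G)` with `U₁` gives `hlegs` for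
`(F₁, G₁)` with `U₁ + 160·Σ_i |cc₀ i|·(eF i·g i + f i·eG i)`. -/
theorem hlegs_of_hlegs_of_legEnvelopes (hdeg : ∀ i ∈ s, p i + q i = 6)
    (hf : ∀ i ∈ s, 0 ≤ f i) (hg : ∀ i ∈ s, 0 ≤ g i) (heF : ∀ i ∈ s, 0 ≤ eF i) (heG : ∀ i ∈ s, 0 ≤ eG i)
    (hF : ∀ r : ℕ, r + 1 ≤ R₀ → ∀ w ∈ annulus 4 r (r + 1), ∀ i ∈ s, |F i w| ≤ f i / ((r : ℝ) + 1) ^ p i)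
    (hG₁ : ∀ r : ℕ, r + 1 ≤ R₀ → ∀ w ∈ annulus 4 r (r + 1), ∀ i ∈ s, |G₁ i w| ≤ g i / ((r : ℝ) + 1) ^ q i)
    (hEF : ∀ r : ℕ, r + 1 ≤ R₀ → ∀ w ∈ annulus 4 r (r + 1), ∀ i ∈ s, |F₁ i w - F i w| ≤ eF i / ((r : ℝ) + 1) ^ (p i + 1))
    (hEG : ∀ r : ℕ, r + 1 ≤ R₀ → ∀ w ∈ annulus 4 r (r + 1), ∀ i ∈ s, |G₁ i w - G i w| ≤ eG i / ((r : ℝ) + 1) ^ (q i + 1))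
    (hlegs : |psum Φ R₀ - ∑ w ∈ annulus 4 0 R₀, toReal w μ * toReal w ν * ∑ i ∈ s, cc₀ i * (F i w * G i w)| ≤ U₁) :
    |psum Φ R₀ - ∑ w ∈ annulus 4 0 R₀, toReal w μ * toReal w ν * ∑ i ∈ s, cc₀ i * (F₁ i w * G₁ i w)|
      ≤ U₁ + 160 * ∑ i ∈ s, |cc₀ i| * (eF i * g i + f i * eG i) := by
  have hD' : 0 ≤ ∑ i ∈ s, |cc₀ i| * (eF i * g i + f i * eG i) :=
    sum_nonneg fun i hi => mul_nonneg (abs_nonneg _)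
      (add_nonneg (mul_nonneg (heF i hi) (hg i hi)) (mul_nonneg (hf i hi) (heG i hi)))
  refine hlegs_of_hlegs_of_septicWindow (T := fun w => ∑ i ∈ s, cc₀ i * (F i w * G i w))
    (T₁ := fun w => ∑ i ∈ s, cc₀ i * (F₁ i w * G₁ i w)) hD' hlegs fun r hr w hw => ?_
  exact sum_mul_sub_sum_mul_le_septic s cc₀ hdeg (hF r hr w hw) (hG₁ r hr w hw) (hEF r hr w hw) (hEG r hr w hw)

end Envelopes

/-! ## §5 The assembled `hrep`: base-point currency + window GERM + shell TAILS -/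

section Assembly

variable {κB ι : Type*} {Bset : Finset κB} {wt : κB → ℝ} {Φ K : κB → Pt → ℝ} {s : Finset ι} {cc₀ : ι → ℝ}
  {F' G' : κB → ι → Pt → ℝ} {μ ν : Fin 4} {a : ℝ}

/-- [folklore] **`hrep` AT ONE BLOCKING FROM GERM + TAILS** (`RepAssembly.hrep_of_basePoint` with `hlegs` discharged by `hlegs_family_of_germWindow`):
`|g − Σ_b wt b·Σ_{w ∈ annulus 4 0 R₀} w_μw_ν·Σ_i cc₀ i F′ b i w G′ b i w| ≤ 160·D + 80·E·(1+Lr/δ)/(R₀+1)`. -/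
theorem hrep_of_germWindow {g : ℝ} (hg : g = ∑ b ∈ Bset, wt b * fullSum (Φ b))
    (hwt0 : ∀ b ∈ Bset, 0 ≤ wt b) (hwt1 : ∑ b ∈ Bset, wt b = 1) {R₀ M : ℕ} (hMR : M ≤ R₀)
    (hΦ : ∀ b ∈ Bset, ∀ w, Φ b w = a * (toReal w μ * toReal w ν * K b w)) {D E δ Lr : ℝ} (hD : 0 ≤ D) (hE : 0 ≤ E)
    (hδ : 0 < δ) (hL : 0 < Lr)
    (hgerm : ∀ b ∈ Bset, ∀ r : ℕ, r + 1 ≤ R₀ → ∀ w ∈ annulus 4 r (r + 1),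
      |a * K b w - ∑ i ∈ s, cc₀ i * (F' b i w * G' b i w)| ≤ D / ((r : ℝ) + 1) ^ 7)
    (htail : ∀ b ∈ Bset, ∀ r : ℕ, M ≤ r → ∀ w ∈ annulus 4 r (r + 1),
      |Φ b w| ≤ E / ((r : ℝ) + 1) ^ 4 * Real.exp (-(δ / Lr) * ((r : ℝ) + 1))) :
    |g - ∑ b ∈ Bset, wt b * ∑ w ∈ annulus 4 0 R₀, toReal w μ * toReal w ν * ∑ i ∈ s, cc₀ i * (F' b i w * G' b i w)|
      ≤ 160 * D + 80 * E * (1 + Lr / δ) / ((R₀ : ℝ) + 1) :=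
  RepAssembly.hrep_of_basePoint hg hwt0 hwt1 hMR hE hδ hL (hlegs_family_of_germWindow hΦ hD hgerm) htail

/-- [folklore] **… `R₀`-free**: `≤ 160·D + 80·E·(1+Lr/δ)` (`RepAssembly.hrep_of_basePoint_uniform`). -/
theorem hrep_of_germWindow_uniform {g : ℝ} (hg : g = ∑ b ∈ Bset, wt b * fullSum (Φ b))
    (hwt0 : ∀ b ∈ Bset, 0 ≤ wt b) (hwt1 : ∑ b ∈ Bset, wt b = 1) {R₀ M : ℕ} (hMR : M ≤ R₀)
    (hΦ : ∀ b ∈ Bset, ∀ w, Φ b w = a * (toReal w μ * toReal w ν * K b w)) {D E δ Lr : ℝ} (hD : 0 ≤ D) (hE : 0 ≤ E)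
    (hδ : 0 < δ) (hL : 0 < Lr)
    (hgerm : ∀ b ∈ Bset, ∀ r : ℕ, r + 1 ≤ R₀ → ∀ w ∈ annulus 4 r (r + 1),
      |a * K b w - ∑ i ∈ s, cc₀ i * (F' b i w * G' b i w)| ≤ D / ((r : ℝ) + 1) ^ 7)
    (htail : ∀ b ∈ Bset, ∀ r : ℕ, M ≤ r → ∀ w ∈ annulus 4 r (r + 1),
      |Φ b w| ≤ E / ((r : ℝ) + 1) ^ 4 * Real.exp (-(δ / Lr) * ((r : ℝ) + 1))) :
    |g - 0 - ∑ b ∈ Bset, wt b * ∑ w ∈ annulus 4 0 R₀, toReal w μ * toReal w ν * ∑ i ∈ s, cc₀ i * (F' b i w * G' b i w)|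
      ≤ 160 * D + 80 * E * (1 + Lr / δ) :=
  RepAssembly.hrep_of_basePoint_uniform hg hwt0 hwt1 hMR hE hδ hL (hlegs_family_of_germWindow hΦ hD hgerm) htail

/-- [folklore] **… `n`-UNIFORM** (`RepAssembly.hrep_of_basePoint_nUniform`: tail scale `Lr := n`, window `n ≤ R₀ + 1`): with `n`-free `D`, `E`, `δ` the
right-hand side `160·D + 80·E·(1+1/δ)` is `n`-free — the `∀ m` binder `hrep` of `FP/AsymptoticEndAvg.hasym_of_legInterface_avg` from TWO POINTWISE
statements per base point (window GERM, shell TAILS). -/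
theorem hrep_of_germWindow_nUniform {g : ℝ} (hg : g = ∑ b ∈ Bset, wt b * fullSum (Φ b))
    (hwt0 : ∀ b ∈ Bset, 0 ≤ wt b) (hwt1 : ∑ b ∈ Bset, wt b = 1) {R₀ M n : ℕ} (hMR : M ≤ R₀) (hn : 1 ≤ n) (hnR : n ≤ R₀ + 1)
    (hΦ : ∀ b ∈ Bset, ∀ w, Φ b w = a * (toReal w μ * toReal w ν * K b w)) {D E δ : ℝ} (hD : 0 ≤ D) (hE : 0 ≤ E) (hδ : 0 < δ)
    (hgerm : ∀ b ∈ Bset, ∀ r : ℕ, r + 1 ≤ R₀ → ∀ w ∈ annulus 4 r (r + 1),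
      |a * K b w - ∑ i ∈ s, cc₀ i * (F' b i w * G' b i w)| ≤ D / ((r : ℝ) + 1) ^ 7)
    (htail : ∀ b ∈ Bset, ∀ r : ℕ, M ≤ r → ∀ w ∈ annulus 4 r (r + 1),
      |Φ b w| ≤ E / ((r : ℝ) + 1) ^ 4 * Real.exp (-(δ / (n : ℝ)) * ((r : ℝ) + 1))) :
    |g - 0 - ∑ b ∈ Bset, wt b * ∑ w ∈ annulus 4 0 R₀, toReal w μ * toReal w ν * ∑ i ∈ s, cc₀ i * (F' b i w * G' b i w)|
      ≤ 160 * D + 80 * E * (1 + 1 / δ) :=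
  RepAssembly.hrep_of_basePoint_nUniform hg hwt0 hwt1 hMR hn hnR hE hδ (hlegs_family_of_germWindow hΦ hD hgerm) htail

end Assembly

end Summit.QuantumFields.BalabanUV.Beta.FP.LegsShellBound

end
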